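import Summits.QuantumFields.BalabanUV.T4Continuum.Support.ShellMeasureLandauPinnedLipschitz
import Summits.QuantumFields.BalabanUV.T4Continuum.Support.ShellMeasurePinnedProp4

/-!
# `T4Continuum.ShellMeasureLandauPinnedKernels` — row S81, file 2: EVERY PINNED CHAIN BINDER OF `ShellMeasureLandauPinnedField`
# INHABITED — the linear letters as kernel operators read through S69 (A), the (P4) letter by locality from the
# chain's OWN flat pair, the coarse field by its support; `z_pin` in decay-TYPE constants only
(cell `pub-balaban`, sub-cell `t4`, spine estimate NE7c (node U5b); NE7c ROUND-2 crew, unit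
`b2b-balaban-t4-ne7c-formalise-leaf-07` gen 7 — row S81 «THE PINNED CHAIN BINDERS `hCp`∕`hGWp`∕`hιp`∕`hHp`∕`hH₁p` INHABITED BY
LOCALITY» of `t4/b2b-balaban-t4-ne7c-p1/LEAVES-NE7c-P1.md` (owner table v3.5, GO; OFFER journal l.17504, file 1 = p227440);
ADDITIVE — imports file 1 `ShellMeasureLandauPinnedLipschitz` (p227440) and the owner's S75 `ShellMeasurePinnedProp4`
(p225698: `norm_ofPin_le_of_support`) ONLY; [folklore]; 0 `def`, 0 `def … : Prop`, 0 sorry, 0 citation)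

HONEST FRAMING.  Finite four-torus programme, rung (B)+1 only — NOT infinite volume, NOT a mass gap, NOT the Clay
problem, NOT summit progress; (B), `BetaPertHyp`, (B^μ) not consumed.  NE7c (`T4IndicatorShell.ShellWeightBound`) is
NOT PRINTED in [Balaban 1983–89] and NOT PROVED; «NE7c ⇐ the named binders» (trigger c3).  Nothing printed is asserted
here; no estimate of Bałaban's is discharged.  PLUMBING on OUR side.

THE POINT.  File 1 inhabited the two NONLINEAR pinned binders (`hCp`, the `W`-half of `hGWp`) of
`ShellMeasureLandauPinnedField.norm_sub_landauField_chart_le` from LOCALITY + flat printed-TYPE pairs.  This file finishes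
the row as booked: at the READING OF RECORD (all five chain spaces FLAT pi-types `Λ → 𝔄`, readings
`(toPiL (pinW δ′ (ϖ ∘ pos)) 1).symm` into S69's pinned spaces, ONE pin profile `ϖ` on a common position space `S` composed
with the index position maps — S69 (A)'s convention) every remaining pinned binder is a NAMED consequence of displayed data:
* §1 **`norm_conj_kerOp_le`** — a linear letter given as S66 f3a's kernel operator `kerOp k` satisfies the reading-form
  bound `‖toPiL′.symm (kerOp k X)‖_pin ≤ B·‖toPiL.symm X‖_pin` for ANY bound `B` on S69's conjugate `‖kerOpPin k δ′ ϖi ϖo‖` —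
  so `hιp`, `hHp`, `hH₁p` and the `𝒢`-half of `hGWp` are LITERALLY S69 (A) `opNorm_kerOpPin_le` (`B = c₀·M` from a
  displayed decay kernel `‖k c b‖ ≤ c₀e^{−δρ}`, (46)∕(103)∕(3.133) decay-halves TYPE) or S79 `opNorm_kerOpPin_eta_le` (the
  η-explicit form, N-ne7cp1-g31-3) — one call each, NOT repeated here;
* §2 **`hWp_of_local`** — the (P4) letter `W : (Λ → 𝔄) → (Λz → ℭ)` LOCAL (located supports `N_W`, reach `r_W`) is
  pinned-Lipschitz on the flat ball `a₃∕2` with `L_W = 2C₄a₃·e^{δ′r_W}` from the chain's OWN `Prop4Hyp W C₄ a₃` (file 1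
  `hCp_of_local`; NO GP, NO located majorant — those serve the OTHER route's pinned `hW`); **`hGWp_of_local`** := file 1
  `hGWp_of_pinnedLipschitz` ∘ §1 ∘ §2 on the chain's ball `ε₄ + B₀b ≤ a₃∕2` ((121)): `q_W = B_𝒢p·2C₄a₃·e^{δ′r_W}`;
* §3 **`hΦp_of_support`** — the coarse field `Φ z` vanishing off the block `{ϖ ∘ pos ≤ 0}` has pinned size `< b` (S75
  `norm_ofPin_le_of_support`, S70 (i));
* §4 **`norm_sub_landauField_chart_le_of_kernels`** — THE ROW'S END: S70 (iv) with ALL pinned binders inhabited.  Data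
  beyond the flat chain lists: the four linear letters AS KERNEL OPERATORS `𝒢 = kerOp k𝒢`, `ι = kerOp kι`, `H = kerOp kH`,
  `H₁ = kerOp kH₁` with bounds `B_𝒢p`, `c_ι`, `B_H`, `B₁ₚ` on their S69 conjugates (S69 (A)'s output shape, DISPLAYED);
  localities of `W` and `C` with reaches `r_W`, `r_C`; the block support of `Φ`; `hRC : 6(ε₄ + B₀b) ≤ R`; smallness
  `B_𝒢p·2C₄a₃e^{δ′r_W} < 1`, `2C₂R·e^{δ′r_C}·c_ι·B_H < 1`.  CONCLUSION:
  **`z_pin = B₁ₚ·b∕((1 − B_𝒢p·2C₄a₃·e^{δ′r_W})(1 − 2C₂R·e^{δ′r_C}·c_ι·B_H))`** — flat scheme constants ((P4) `C₄, a₃`,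
  (44) `C₂, R`, (75) `b`), pinned operator bounds of LINEAR letters, geometry (`r_W`, `r_C`, `δ′`); nothing else.
η-BOOKKEEPING (N-ne7cp1-g31-3 ∕ S79).  Each of `B_𝒢p`, `c_ι`, `B_H`, `B₁ₚ` is a product `c₀·M` whose η-freeness is the
PRODUCT's (S79 `opNorm_kerOpPin_eta_le`: density bound × cell volume × reduced-rate sum in physical distance); `C₄a₃` and
`C₂R` are η-free in B11's weighted currencies at the live levels only through S65's `WMax` bookkeeping — at the flat-sup
reading used here they are the ONE-GRID ∕ level-0 instance (the `WMax`-based twin of §§2–4 is the live-level form, on GO);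
`r_W`, `r_C` in the pin's units.
DISPLAYED, NOT DISCHARGED (c2): the decay kernels of `𝒢`, `ι`, `H`, `H₁` ((3.133)∕Thm 3.3, (46), (103) TYPE — W-a∕W-h),
the flat lists, W-c [dict]; nothing of Bałaban's at a live level is discharged; NOTHING in the countdown moves; NE7c NOT
PROVED; spine PROVED 0∕9.  HONEST DEPENDENCY (cell): continuum YM on T⁴ ⇐ BetaPertH ∧ nine spine estimates (0/9 proved);
BetaPertH ⇐ (D1) ∧ (D4) ∧ CAP+tail; G-an2-4 gates asym, D1 and NE2/3/4.
-/

noncomputable section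

open Set Metric

namespace Summit.QuantumFields.BalabanUV.T4Continuum.ShellMeasureLandauPinnedKernels

open Literature.MathematicalPhysics.QuantumFieldTheory.Balaban1983to89
open B11Prop6Scheme (Prop4Hyp)
open Summit.QuantumFields.BalabanUV.T4Continuum.ShellMeasureMultiGridNorms (WSup)
open Summit.QuantumFields.BalabanUV.T4Continuum.ShellMeasureMultiGridNorms.WSup (toPiL toPiL_apply toPiL_symm_apply)
open Summit.QuantumFields.BalabanUV.T4Continuum.ShellMeasureDecayKernelSums (kerOp kerOp_apply)
open Summit.QuantumFields.BalabanUV.T4Continuum.ShellMeasurePinnedNorm (pinW pinW_apply kerOpPin)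
open Summit.QuantumFields.BalabanUV.T4Continuum.ShellMeasurePinnedProp4 (norm_ofPin_le_of_support)
open Summit.QuantumFields.BalabanUV.T4Continuum.ShellMeasureLandauHolonomy (solAt landauExp)
open Summit.QuantumFields.BalabanUV.T4Continuum.ShellMeasureLandauPinnedLipschitz (hCp_of_local hGWp_of_pinnedLipschitz
  norm_sub_landauField_chart_le_of_local)

/-! ## §1 A linear letter given as a kernel operator: the reading-form bound from S69's conjugate -/

section Linear

variable {Λ Λ' : Type*} [Fintype Λ] [Fintype Λ'] {𝔄 𝔅 : Type*} [NormedAddCommGroup 𝔄] [NormedSpace ℂ 𝔄]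
  [NormedAddCommGroup 𝔅] [NormedSpace ℂ 𝔅]

/-- The reading of `kerOp k X` is S69's conjugate `kerOpPin` applied to the reading of `X`. [folklore] -/
theorem toPiL_symm_kerOp (k : Λ' → Λ → (𝔄 →L[ℂ] 𝔅)) (δ' : ℝ) (ϖi : Λ → ℝ) (ϖo : Λ' → ℝ) (X : Λ → 𝔄) :
    ((toPiL (pinW δ' ϖo) 1).symm (kerOp k X) : WSup (pinW δ' ϖo) 1 𝔅) =
      kerOpPin k δ' ϖi ϖo ((toPiL (pinW δ' ϖi) 1).symm X) := by
  simp only [kerOpPin, ContinuousLinearMap.coe_comp, ContinuousLinearEquiv.coe_coe, Function.comp_apply,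
    ContinuousLinearEquiv.apply_symm_apply]

/-- **A LINEAR LETTER AS A KERNEL OPERATOR: THE READING-FORM PINNED BOUND.**  For `kerOp k : (Λ → 𝔄) →L[ℂ] (Λ′ → 𝔅)` and
ANY bound `‖kerOpPin k δ′ ϖi ϖo‖ ≤ B` on S69's conjugate (S69 (A) `opNorm_kerOpPin_le`: `B = c₀·M` from a displayed decay
kernel; S79 `opNorm_kerOpPin_eta_le`: the η-explicit form): `‖toPiL′.symm (kerOp k X)‖_pin ≤ B·‖toPiL.symm X‖_pin` for every
flat `X` — LITERALLY the shape of `ShellMeasureLandauPinnedField`'s `hιp` ∕ `hHp` ∕ `hH₁p` and of file 1's `h𝒢p` at the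
reading of record. [folklore] -/
theorem norm_conj_kerOp_le (k : Λ' → Λ → (𝔄 →L[ℂ] 𝔅)) (δ' : ℝ) (ϖi : Λ → ℝ) (ϖo : Λ' → ℝ) {B : ℝ}
    (hB : ‖kerOpPin k δ' ϖi ϖo‖ ≤ B) (X : Λ → 𝔄) :
    ‖((toPiL (pinW δ' ϖo) 1).symm (kerOp k X) : WSup (pinW δ' ϖo) 1 𝔅)‖ ≤
      B * ‖((toPiL (pinW δ' ϖi) 1).symm X : WSup (pinW δ' ϖi) 1 𝔄)‖ := by
  rw [toPiL_symm_kerOp k δ' ϖi ϖo X]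
  exact ((kerOpPin k δ' ϖi ϖo).le_opNorm _).trans (mul_le_mul_of_nonneg_right hB (norm_nonneg _))

end Linear

/-! ## §2 The (P4) letter by locality from the chain's own flat pair -/

section P4

variable {Λ Λz : Type*} [Fintype Λ] [Fintype Λz] {𝔄 ℭ : Type*} [NormedAddCommGroup 𝔄] [NormedSpace ℂ 𝔄]
  [NormedAddCommGroup ℭ] [NormedSpace ℂ ℭ]

/-- **THE (P4) LETTER IS PINNED-LIPSCHITZ ON THE FLAT HALF BALL BY LOCALITY — `hWp` FROM THE CHAIN's OWN `Prop4Hyp`.**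
`W : (Λ → 𝔄) → (Λz → ℭ)` with located supports `N_W` (`hloc`), reach `N_W c b → ϖz c − r_W ≤ ϖ b`, `δ′ ≥ 0`, and B11
Prop. 4's flat pair `Prop4Hyp W C₄ a₃` (`0 ≤ C₄`, `0 < a₃`) ⟹ for all flat `‖Y‖, ‖Y′‖ < a₃∕2`:
`‖toPiLz.symm (W Y) − toPiLz.symm (W Y′)‖_pin ≤ (2C₄a₃·e^{δ′r_W})·‖toPiL.symm Y − toPiL.symm Y′‖_pin` (file 1 `hCp_of_local`
with the (P4) pair in place of the (44) pair).  Any level; no GP, no located majorant. [folklore] -/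
theorem hWp_of_local {δ' : ℝ} (hδ' : 0 ≤ δ') (ϖ : Λ → ℝ) (ϖz : Λz → ℝ) {W : (Λ → 𝔄) → (Λz → ℭ)}
    (N : Λz → Λ → Prop) (hloc : ∀ A A' : Λ → 𝔄, ∀ c, (∀ b, N c b → A b = A' b) → W A c = W A' c)
    {rW : ℝ} (hreach : ∀ c b, N c b → ϖz c - rW ≤ ϖ b) {C₄ a₃ : ℝ} (hC₄ : 0 ≤ C₄) (ha₃ : 0 < a₃)
    (hW : Prop4Hyp W C₄ a₃) :
    ∀ Y Y' : Λ → 𝔄, ‖Y‖ < a₃ / 2 → ‖Y'‖ < a₃ / 2 →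
      ‖((toPiL (pinW δ' ϖz) 1).symm (W Y) - (toPiL (pinW δ' ϖz) 1).symm (W Y') : WSup (pinW δ' ϖz) 1 ℭ)‖ ≤
        2 * C₄ * a₃ * Real.exp (δ' * rW) *
          ‖((toPiL (pinW δ' ϖ) 1).symm Y - (toPiL (pinW δ' ϖ) 1).symm Y' : WSup (pinW δ' ϖ) 1 𝔄)‖ := by
  have hWd : DifferentiableOn ℂ W (ball 0 a₃) := by
    have e : ball (0 : Λ → 𝔄) a₃ = {Y | ‖Y‖ < a₃} := by
      ext Y
      simp
    rw [e]
    exact hW.differentiableOn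
  exact hCp_of_local hδ' ϖ ϖz N hloc hreach hC₄ ha₃ hW.quad hWd

variable {P𝒴 P𝒵 : Type*}

/-- **`hGWp` AT THE READING OF RECORD** (file 1 `hGWp_of_pinnedLipschitz` ∘ §1 ∘ §2): the propagator AS A KERNEL OPERATOR
`𝒢 = kerOp k𝒢 : (Λz → ℭ) →L[ℂ] (Λ → 𝔄)` with a bound `B_𝒢p` on its S69 conjugate, the (P4) letter local with reach `r_W`
and `Prop4Hyp W C₄ a₃`, the chain's ball `ε ≤ a₃∕2` ((121): `2ε ≤ a₃`) ⟹ `ShellMeasureLandauPinnedField`'s `hGWp` on the flat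
ball `ε` with **`q_W = B_𝒢p·(2C₄a₃·e^{δ′r_W})`**. [folklore] -/
theorem hGWp_of_local {δ' : ℝ} (hδ' : 0 ≤ δ') (ϖ : Λ → ℝ) (ϖz : Λz → ℝ) (k𝒢 : Λ → Λz → (ℭ →L[ℂ] 𝔄)) {B𝒢p : ℝ}
    (hB𝒢p : 0 ≤ B𝒢p) (h𝒢p : ‖kerOpPin k𝒢 δ' ϖz ϖ‖ ≤ B𝒢p) {W : (Λ → 𝔄) → (Λz → ℭ)}
    (N : Λz → Λ → Prop) (hloc : ∀ A A' : Λ → 𝔄, ∀ c, (∀ b, N c b → A b = A' b) → W A c = W A' c)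
    {rW : ℝ} (hreach : ∀ c b, N c b → ϖz c - rW ≤ ϖ b) {C₄ a₃ ε : ℝ} (hC₄ : 0 ≤ C₄) (hε : 2 * ε ≤ a₃) (hε0 : 0 < ε)
    (hW : Prop4Hyp W C₄ a₃) :
    ∀ Y Y' : Λ → 𝔄, ‖Y‖ < ε → ‖Y'‖ < ε →
      ‖((toPiL (pinW δ' ϖ) 1).symm (kerOp k𝒢 (W Y)) - (toPiL (pinW δ' ϖ) 1).symm (kerOp k𝒢 (W Y')) :
          WSup (pinW δ' ϖ) 1 𝔄)‖ ≤
        B𝒢p * (2 * C₄ * a₃ * Real.exp (δ' * rW)) *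
          ‖((toPiL (pinW δ' ϖ) 1).symm Y - (toPiL (pinW δ' ϖ) 1).symm Y' : WSup (pinW δ' ϖ) 1 𝔄)‖ := by
  have ha₃ : 0 < a₃ := by linarith
  have hWp := hWp_of_local hδ' ϖ ϖz N hloc hreach hC₄ ha₃ hW
  have h := hGWp_of_pinnedLipschitz (𝒢 := kerOp k𝒢) (W := W) (ε := ε)
    (toPiL (𝔄 := 𝔄) (pinW δ' ϖ) 1).symm.toContinuousLinearMap
    (toPiL (𝔄 := ℭ) (pinW δ' ϖz) 1).symm.toContinuousLinearMap hB𝒢p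
    (fun f => by simpa only [ContinuousLinearEquiv.coe_coe] using norm_conj_kerOp_le k𝒢 δ' ϖz ϖ h𝒢p f)
    (fun Y Y' hY hY' => by
      simpa only [ContinuousLinearEquiv.coe_coe] using
        hWp Y Y' (hY.trans_le (by linarith)) (hY'.trans_le (by linarith)))
  intro Y Y' hY hY'
  simpa only [ContinuousLinearEquiv.coe_coe] using h Y Y' hY hY'

end P4

/-! ## §3 The coarse field by its support -/

section Support

variable {Λb : Type*} [Fintype Λb] {𝔇 : Type*} [NormedAddCommGroup 𝔇] [NormedSpace ℂ 𝔇]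

/-- **`hΦp` FROM THE BLOCK SUPPORT** (S70 (i), S75 `norm_ofPin_le_of_support`): if every `Φ z` vanishes off the block
`{ϖb ≤ 0}` and `‖Φ z‖ < b` on the chart ball, then `‖toPiLb.symm (Φ z)‖_pin ≤ b` there (`δ′ ≥ 0`). [folklore] -/
theorem hΦp_of_support {m₀ : ℕ} {δ' : ℝ} (hδ' : 0 ≤ δ') (ϖb : Λb → ℝ) {Φ : (Fin m₀ → ℂ) → (Λb → 𝔇)} {rΦ b : ℝ}
    (hsupp : ∀ z : Fin m₀ → ℂ, ∀ i, 0 < ϖb i → Φ z i = 0) (hΦ : ∀ z ∈ ball (0 : Fin m₀ → ℂ) rΦ, ‖Φ z‖ < b) :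
    ∀ z ∈ ball (0 : Fin m₀ → ℂ) rΦ, ‖((toPiL (pinW δ' ϖb) 1).symm (Φ z) : WSup (pinW δ' ϖb) 1 𝔇)‖ ≤ b :=
  fun z hz => (norm_ofPin_le_of_support hδ' ϖb (Φ z) (hsupp z)).trans (hΦ z hz).le

end Support

/-! ## §4 The row's END: S70 (iv) with every pinned binder inhabited -/

section End

variable {Λ Λz Λ' Λx Λb : Type*} [Fintype Λ] [Fintype Λz] [Fintype Λ'] [Fintype Λx] [Fintype Λb]
variable {𝔄 ℭ 𝔄' 𝔅 𝔇 : Type*} [NormedAddCommGroup 𝔄] [NormedSpace ℂ 𝔄] [CompleteSpace 𝔄]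
  [NormedAddCommGroup ℭ] [NormedSpace ℂ ℭ] [NormedAddCommGroup 𝔄'] [NormedSpace ℂ 𝔄']
  [NormedAddCommGroup 𝔅] [NormedSpace ℂ 𝔅] [CompleteSpace 𝔅] [NormedAddCommGroup 𝔇] [NormedSpace ℂ 𝔇]

/-- **S70 (iv) WITH EVERY PINNED BINDER INHABITED — `z_pin` IN DECAY-TYPE CONSTANTS ONLY.**  The LD chain at the reading of
record: all five spaces FLAT pi-types (`𝒴 := Λ → 𝔄`, `𝒵 := Λz → ℭ`, `𝒴′ := Λ′ → 𝔄′`, `𝒳 := Λx → 𝔅`, `ℬ := Λb → 𝔇`, sup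
norms), readings `(toPiL (pinW δ′ ϖ·) 1).symm` with pins `ϖ, ϖz, ϖ′, ϖx, ϖb` (typically ONE profile on a position space composed
with the index position maps), `δ′ ≥ 0`.  FLAT lists VERBATIM from `ShellMeasureLandauPinnedField.norm_sub_landauField_chart_le`
((P2) `h𝒢`, (P4) `hW`, (118)∕(121) at `a = B₀b`, (103) `hH₁`, (75)-TYPE `hΦ` with `Φ 0 = 0`, (44) `hCq`∕`hCd` at radius `R`,
`hι`, (46) `hH`, (54) `hq`) with Sect. C run at radius `R∕2` (`hRC : 6(ε₄ + B₀b) ≤ R`), the four LINEAR letters AS KERNEL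
OPERATORS `kerOp k𝒢`, `kerOp kι`, `kerOp kH`, `kerOp kH₁` with bounds `B_𝒢p`, `c_ι`, `B_H`, `B₁ₚ` on their S69 conjugates
(S69 (A) ∕ S79 output shape — DISPLAYED decay halves), the (P4) letter and the (44) letter LOCAL with reaches `r_W`, `r_C`,
the coarse field supported on the block `{ϖb ≤ 0}`, smallness `B_𝒢p·(2C₄a₃e^{δ′r_W}) < 1` and
`2C₂R·e^{δ′r_C}·c_ι·B_H < 1`.  CONCLUSION, for `Z_V z = landauExp C ι H (4C₂(ε₄+B₀b)²) (solAt 𝒢 0 W ε₄ 0 (H₁ (Φ z)) + H₁ (Φ z))`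
and every `z` in the chart ball: `‖π (Z_V z) − π (Z_V 0)‖_pin ≤ z_pin` and `‖π (Z_V z)‖_pin ≤ z_pin`,
**`z_pin = B₁ₚ·b∕((1 − B_𝒢p·(2C₄a₃·e^{δ′r_W}))(1 − 2C₂R·e^{δ′r_C}·c_ι·B_H))`**.  Nothing printed is asserted; no estimate of
Bałaban's discharged; NE7c NOT PROVED. [folklore] -/
theorem norm_sub_landauField_chart_le_of_kernels {m₀ : ℕ} {δ' : ℝ} (hδ' : 0 ≤ δ')
    (ϖ : Λ → ℝ) (ϖz : Λz → ℝ) (ϖ' : Λ' → ℝ) (ϖx : Λx → ℝ) (ϖb : Λb → ℝ)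
    -- the four linear letters as kernel operators, with bounds on their S69 conjugates (DISPLAYED decay halves)
    (k𝒢 : Λ → Λz → (ℭ →L[ℂ] 𝔄)) (kι : Λ' → Λ → (𝔄 →L[ℂ] 𝔄')) (kH : Λ → Λx → (𝔅 →L[ℂ] 𝔄))
    (kH₁ : Λ → Λb → (𝔇 →L[ℂ] 𝔄)) {B𝒢p cι BH B₁p : ℝ} (hB𝒢p : 0 ≤ B𝒢p) (hcι : 0 ≤ cι) (hBH : 0 ≤ BH)
    (hB₁p : 0 ≤ B₁p) (h𝒢p : ‖kerOpPin k𝒢 δ' ϖz ϖ‖ ≤ B𝒢p) (hιp : ‖kerOpPin kι δ' ϖ ϖ'‖ ≤ cι)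
    (hHp : ‖kerOpPin kH δ' ϖx ϖ‖ ≤ BH) (hH₁p : ‖kerOpPin kH₁ δ' ϖb ϖ‖ ≤ B₁p)
    -- the flat lists
    {W : (Λ → 𝔄) → (Λz → ℭ)} {B₀ C₄ a₃ ε₄ b : ℝ} {C : (Λ' → 𝔄') → (Λx → 𝔅)} {C₂ R : ℝ}
    {Φ : (Fin m₀ → ℂ) → (Λb → 𝔇)} {rΦ : ℝ}
    (h𝒢 : ∀ f, ‖kerOp k𝒢 f‖ ≤ B₀ * ‖f‖) (hW : Prop4Hyp W C₄ a₃) (hB₀ : 0 < B₀) (hC₄ : 0 ≤ C₄) (hε₄ : 0 ≤ ε₄)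
    (hdom : 2 * (ε₄ + B₀ * b) ≤ a₃) (hself : B₀ * C₄ * (ε₄ + B₀ * b) ^ 2 ≤ ε₄)
    (hcontr : 4 * B₀ * C₄ * (ε₄ + B₀ * b) < 1)
    (hH₁ : ∀ B, ‖kerOp kH₁ B‖ ≤ B₀ * ‖B‖) (hΦ0 : Φ 0 = 0) (hΦ : ∀ z ∈ ball (0 : Fin m₀ → ℂ) rΦ, ‖Φ z‖ < b)
    (hC₂ : 0 ≤ C₂) (hCq : ∀ Z : Λ' → 𝔄', ‖Z‖ < R → ‖C Z‖ ≤ C₂ * ‖Z‖ ^ 2) (hCd : DifferentiableOn ℂ C (ball 0 R))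
    (hι : ∀ Y, ‖kerOp kι Y‖ ≤ ‖Y‖) (hH : ∀ X, ‖kerOp kH X‖ ≤ B₀ * ‖X‖) (hq : 9 * C₂ * B₀ * (ε₄ + B₀ * b) < 1)
    (hRC : 6 * (ε₄ + B₀ * b) ≤ R)
    -- localities (in place of `hGWp`'s `W`-half and of `hCp`) and the block support (in place of `hΦp`)
    (NW : Λz → Λ → Prop) (hlocW : ∀ A A' : Λ → 𝔄, ∀ c, (∀ b', NW c b' → A b' = A' b') → W A c = W A' c)
    {rW : ℝ} (hreachW : ∀ c b', NW c b' → ϖz c - rW ≤ ϖ b')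
    (NC : Λx → Λ' → Prop) (hlocC : ∀ A A' : Λ' → 𝔄', ∀ c, (∀ b', NC c b' → A b' = A' b') → C A c = C A' c)
    {rC : ℝ} (hreachC : ∀ c b', NC c b' → ϖx c - rC ≤ ϖ' b')
    (hsupp : ∀ z : Fin m₀ → ℂ, ∀ i, 0 < ϖb i → Φ z i = 0)
    -- smallness of the two contraction numbers in the pinned currency (DISPLAYED arithmetic)
    (hqW : B𝒢p * (2 * C₄ * a₃ * Real.exp (δ' * rW)) < 1) (hk : 2 * C₂ * R * Real.exp (δ' * rC) * cι * BH < 1)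
    {z : Fin m₀ → ℂ} (hz : z ∈ ball (0 : Fin m₀ → ℂ) rΦ) :
    ‖((toPiL (pinW δ' ϖ) 1).symm (landauExp C (kerOp kι) (kerOp kH) (4 * C₂ * (ε₄ + B₀ * b) ^ 2)
          (solAt (kerOp k𝒢) 0 W ε₄ (0 : Λz → ℭ) (kerOp kH₁ (Φ z)) + kerOp kH₁ (Φ z))) -
        (toPiL (pinW δ' ϖ) 1).symm (landauExp C (kerOp kι) (kerOp kH) (4 * C₂ * (ε₄ + B₀ * b) ^ 2)
          (solAt (kerOp k𝒢) 0 W ε₄ (0 : Λz → ℭ) (kerOp kH₁ (Φ 0)) + kerOp kH₁ (Φ 0))) : WSup (pinW δ' ϖ) 1 𝔄)‖ ≤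
      B₁p * b / ((1 - B𝒢p * (2 * C₄ * a₃ * Real.exp (δ' * rW))) * (1 - 2 * C₂ * R * Real.exp (δ' * rC) * cι * BH)) ∧
    ‖((toPiL (pinW δ' ϖ) 1).symm (landauExp C (kerOp kι) (kerOp kH) (4 * C₂ * (ε₄ + B₀ * b) ^ 2)
          (solAt (kerOp k𝒢) 0 W ε₄ (0 : Λz → ℭ) (kerOp kH₁ (Φ z)) + kerOp kH₁ (Φ z))) : WSup (pinW δ' ϖ) 1 𝔄)‖ ≤
      B₁p * b / ((1 - B𝒢p * (2 * C₄ * a₃ * Real.exp (δ' * rW))) * (1 - 2 * C₂ * R * Real.exp (δ' * rC) * cι * BH)) := by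
  have hrΦ : 0 < rΦ := (norm_nonneg z).trans_lt (mem_ball_zero_iff.1 hz)
  have hb : 0 < b := by have h := hΦ 0 (mem_ball_self hrΦ); rwa [hΦ0, norm_zero] at h
  have hε : 0 < ε₄ + B₀ * b := add_pos_of_nonneg_of_pos hε₄ (mul_pos hB₀ hb)
  -- the `W`-slot (§2 with §1 for `𝒢`) on the chain's ball
  have hWp := hWp_of_local hδ' ϖ ϖz NW hlocW hreachW hC₄ (by linarith) hW
  have h := norm_sub_landauField_chart_le_of_local (𝒢 := kerOp k𝒢) (W := W) (H₁ := kerOp kH₁) (ι := kerOp kι)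
    (H := kerOp kH) (toPiL (𝔄 := 𝔄) (pinW δ' ϖ) 1).symm.toContinuousLinearMap
    (toPiL (𝔄 := ℭ) (pinW δ' ϖz) 1).symm.toContinuousLinearMap
    (toPiL (𝔄 := 𝔇) (pinW δ' ϖb) 1).symm.toContinuousLinearMap hδ' ϖ' ϖx h𝒢 hW hB₀ hC₄ hε₄ hdom hself hcontr hH₁ hΦ0
    hΦ hC₂ hCq hCd hι hH hq hRC NC hlocC hreachC hB𝒢p
    (fun f => by simpa only [ContinuousLinearEquiv.coe_coe] using norm_conj_kerOp_le k𝒢 δ' ϖz ϖ h𝒢p f)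
    (fun Y Y' hY hY' => by
      simpa only [ContinuousLinearEquiv.coe_coe] using
        hWp Y Y' (hY.trans_le (by linarith)) (hY'.trans_le (by linarith)))
    hqW (fun Y => norm_conj_kerOp_le kι δ' ϖ ϖ' hιp Y)
    (fun X => by simpa only [ContinuousLinearEquiv.coe_coe] using norm_conj_kerOp_le kH δ' ϖx ϖ hHp X)
    hcι hBH hk hB₁p
    (fun B => by simpa only [ContinuousLinearEquiv.coe_coe] using norm_conj_kerOp_le kH₁ δ' ϖb ϖ hH₁p B)
    (fun z' hz' => by
      simpa only [ContinuousLinearEquiv.coe_coe] using hΦp_of_support hδ' ϖb hsupp hΦ z' hz') hz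
  simpa only [ContinuousLinearEquiv.coe_coe] using h

end End

end Summit.QuantumFields.BalabanUV.T4Continuum.ShellMeasureLandauPinnedKernels

end
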